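import Summits.AtomisticToContinuum.Crystallization.Theorems.FrustratedLawDichotomyStrainedPatchShearDoor

/-!
# Strained patch · PairTube LENGTH COLLAR — `relConeLen`, its host-graded form, the generic sector glue, the collar cells and their junction
(decomp-a2c lens-5 g100; critic rows 1612 (D)(3), 1617 (2)–(4); census CERTC48)

The T/E collar branch (3) of the door 𝔇′: the score-relevant cone `β + s·ℓ` is imposed ONLY on host pairs of length `ℓ ≤ ℓ_c` (and `min` host radius
`≤ R_E`); longer pairs keep the dipole value `2τ₀` (vacuous under the scalar boxes).  Census CERTC48 (fixed-multiplier transfer of the three FZ09 certg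
columns): the LENGTH collar `ℓ_c = 29/10` keeps `+15.4 / +21.1 / +19.0 %` of `S_hom` (PASS-est, margin rule `+10 %`), `ℓ_c = 7/2` `+18.6 / +23.9 / +22.4 %`,
`ℓ_c = 11/5` THIN, the endpoint collar (`relConeIn`) FAILS (`−22 / −7 / −12 %`).  Collar of record := `ℓ_c = 29/10` (row 1617 (2)).

* §1 `relConeLen RE ℓc β s τ₀` (the table), `relConeLen RE (9/2) = relCone RE` (`rfl`), `relCone ≤ relConeLen ≤ pairSum (constTol τ₀)` under the cap.
* §2 `relConeLenBy RE ℓc βf sf τ₀` (host-graded), `relConeBy ≤ relConeLenBy` (so the collar E-cell is the STRONGER E-cell and the collar N-cell the WEAKER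
  N-cell: `TubeFloorGB.anti_pair` / `RefineGB.mono`), cap lemma.
* §3 GENERIC host-class glue of pair tables: `stepPair 𝓟 B₁ B₂`, `tubeFloorGB_stepPair` (E-side), `sectorPair 𝓟 B T = stepPair 𝓟 B (pairSum T)`.
* §4 the cells: (E∣·)ᴸ `TubeFloorGBLenBy`, (N∣·)ᴸ `RefineGBLenByAt`; record instances at `ℓ_c = 29/10`; transfer lemmas both ways.
* §5 junctions: the collar pair on a whole family (`coreOff_record_of_collarPair_at_26_5`, B-generic root `coreOff_of_tubeFloorGB_of_coarse_of_refineGB`),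
  and the THREE- and FOUR-SECTOR cuts with the collar on the 𝔇′ sector only (other sectors at their `relConeBy` tables, dilated sector pair-blind).
TAGS: (E∣𝔇′)ᴸ²·⁹ [E-PRICED · PASS-est · CERTIFICATE-BY-TRANSFER (CERTC48); optional confirming certg re-run ≈ 4 core-h NOT authorised (r1617 (4))] ·
(N∣𝔇′)ᴸ²·⁹ [UNDECIDED · INSTRUMENT = RLOC L2.9 (census queue (4), κ ∈ {0,4,8,12})].  [formal bookkeeping] 0 sorry, no new axioms.
-/

noncomputable section

open scoped BigOperators Classical
open Summit.AtomisticToContinuum.Crystallization.Theorems.ChargedEnergyGapNegative (eStar E3)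
open Summit.AtomisticToContinuum.Crystallization.Theorems.FrustratedLawDichotomyRangeCut
open Summit.AtomisticToContinuum.Crystallization.Theorems.FrustratedLawDichotomyAveragingCut (ballAvg)
open Summit.AtomisticToContinuum.Crystallization.Theorems.FrustratedLawDichotomyStrainedPatchHomSplit
open Summit.AtomisticToContinuum.Crystallization.Theorems.FrustratedLawDichotomyStrainedPatchCoreTube (NearHomIsoAt CoreOffTubeFloor)
open Summit.AtomisticToContinuum.Crystallization.Theorems.FrustratedLawDichotomyStrainedPatchChartFamilies (ChartBy FamilyLE familyLE_refl)
open Summit.AtomisticToContinuum.Crystallization.Theorems.FrustratedLawDichotomyStrainedPatchQuantSlaving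
open Summit.AtomisticToContinuum.Crystallization.Theorems.FrustratedLawDichotomyStrainedPatchHostCells (TubeFloor FamP)
open Summit.AtomisticToContinuum.Crystallization.Theorems.FrustratedLawDichotomyStrainedPatchGradedTube
open Summit.AtomisticToContinuum.Crystallization.Theorems.FrustratedLawDichotomyStrainedPatchCoverBridge
open Summit.AtomisticToContinuum.Crystallization.Theorems.FrustratedLawDichotomyStrainedPatchPairTube
open Summit.AtomisticToContinuum.Crystallization.Theorems.FrustratedLawDichotomyStrainedPatchConeAnatomy
open Summit.AtomisticToContinuum.Crystallization.Theorems.FrustratedLawDichotomyStrainedPatchStiffSector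
open Summit.AtomisticToContinuum.Crystallization.Theorems.FrustratedLawDichotomyStrainedPatchStiffDoor
open Summit.AtomisticToContinuum.Crystallization.Theorems.FrustratedLawDichotomyStrainedPatchShearDoor

namespace Summit.AtomisticToContinuum.Crystallization.Theorems.FrustratedLawDichotomyStrainedPatchPairTubeCollar

/-! ## §1. The length-collared cone -/

/-- ★ (piece) [route statement · this cell; NOT a literature fact] `relConeLen RE ℓc β s τ₀` — the cone `β + s·|z₀ a − z₀ b|` on host pairs of LENGTH `≤ ℓc` with `min` host radius `≤ RE`; the dipole value `2τ₀`
on every other pair (vacuous under the scalar boxes).  `ℓc = 9/2` is the record `relCone`. -/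
def relConeLen (RE ℓc β s τ₀ : ℝ) : PairTab := fun _ z₀ c₀ a b =>
  if dist (z₀ a) (z₀ b) ≤ ℓc ∧ min (dist (z₀ a) (z₀ c₀)) (dist (z₀ b) (z₀ c₀)) ≤ RE then β + s * dist (z₀ a) (z₀ b) else 2 * τ₀

section RelConeLen

variable {RE RE' ℓc ℓc' β β' s s' τ₀ : ℝ} {M₀ : ℕ} {z₀ : Fin M₀ → E3} {c₀ : Fin M₀}

/-- The record cone IS the collar at `ℓc = 9/2`. [formal bookkeeping] -/
theorem relConeLen_nine_halves (RE β s τ₀ : ℝ) : relConeLen RE (9 / 2) β s τ₀ = relCone RE β s τ₀ := rfl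

/-- [formal bookkeeping; lane docstring, hand-2 g42] -/
theorem relConeLen_of_short {a b : Fin M₀} (h : dist (z₀ a) (z₀ b) ≤ ℓc ∧ min (dist (z₀ a) (z₀ c₀)) (dist (z₀ b) (z₀ c₀)) ≤ RE) :
    relConeLen RE ℓc β s τ₀ M₀ z₀ c₀ a b = β + s * dist (z₀ a) (z₀ b) := by
  unfold relConeLen; rw [if_pos h]

/-- [formal bookkeeping; lane docstring, hand-2 g42] -/
theorem relConeLen_of_not_short {a b : Fin M₀} (h : ¬(dist (z₀ a) (z₀ b) ≤ ℓc ∧ min (dist (z₀ a) (z₀ c₀)) (dist (z₀ b) (z₀ c₀)) ≤ RE)) :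
    relConeLen RE ℓc β s τ₀ M₀ z₀ c₀ a b = 2 * τ₀ := by
  unfold relConeLen; rw [if_neg h]

/-- ★ The collar table is LOOSER than the record cone (the cone is dropped, not tightened, on long pairs): `relCone ≤ relConeLen` pointwise, for
`ℓc ≤ 9/2`, `0 ≤ s` and the cap `β + s·(9/2) ≤ 2τ₀`. [formal bookkeeping] -/
theorem relCone_le_relConeLen (hℓ : ℓc ≤ 9 / 2) (hs : 0 ≤ s) (hcap : β + s * (9 / 2) ≤ 2 * τ₀) :
    PairLE (relCone RE β s τ₀) (relConeLen RE ℓc β s τ₀) := by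
  intro M₀ z₀ c₀ a b
  by_cases h₁ : dist (z₀ a) (z₀ b) ≤ ℓc ∧ min (dist (z₀ a) (z₀ c₀)) (dist (z₀ b) (z₀ c₀)) ≤ RE
  · rw [relConeLen_of_short h₁, relCone_of_rel ⟨h₁.1.trans hℓ, h₁.2⟩]
  · rw [relConeLen_of_not_short h₁]
    by_cases h₂ : dist (z₀ a) (z₀ b) ≤ 9 / 2 ∧ min (dist (z₀ a) (z₀ c₀)) (dist (z₀ b) (z₀ c₀)) ≤ RE
    · rw [relCone_of_rel h₂]
      nlinarith [h₂.1]
    · rw [relCone_of_not_rel h₂]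

/-- ★ … and it is CAPPED by the scalar site sums (`β + s·ℓc ≤ 2τ₀`, `0 ≤ s`): the junctions' `hcap`. [formal bookkeeping] -/
theorem relConeLen_le_pairSum (hs : 0 ≤ s) (hcap : β + s * ℓc ≤ 2 * τ₀) : PairLE (relConeLen RE ℓc β s τ₀) (pairSum (constTol τ₀)) := by
  intro M₀ z₀ c₀ a b
  simp only [pairSum, constTol_apply]
  by_cases h₁ : dist (z₀ a) (z₀ b) ≤ ℓc ∧ min (dist (z₀ a) (z₀ c₀)) (dist (z₀ b) (z₀ c₀)) ≤ RE
  · rw [relConeLen_of_short h₁]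
    nlinarith [h₁.1]
  · rw [relConeLen_of_not_short h₁]; linarith

/-- MONOTONICITY of the shape: smaller core radius and collar length, larger intercept and (non-negative) slope give a LARGER table, under the cap
`β' + s'·ℓc ≤ 2τ₀` at the larger collar. [formal bookkeeping] -/
theorem relConeLen_mono (hRE : RE' ≤ RE) (hℓ : ℓc' ≤ ℓc) (hβ : β ≤ β') (hs : s ≤ s') (hs'0 : 0 ≤ s') (hcap : β' + s' * ℓc ≤ 2 * τ₀) :
    PairLE (relConeLen RE ℓc β s τ₀) (relConeLen RE' ℓc' β' s' τ₀) := by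
  intro M₀ z₀ c₀ a b
  have hd : 0 ≤ dist (z₀ a) (z₀ b) := dist_nonneg
  by_cases h₁ : dist (z₀ a) (z₀ b) ≤ ℓc' ∧ min (dist (z₀ a) (z₀ c₀)) (dist (z₀ b) (z₀ c₀)) ≤ RE'
  · rw [relConeLen_of_short h₁, relConeLen_of_short ⟨h₁.1.trans hℓ, h₁.2.trans hRE⟩]
    nlinarith
  · rw [relConeLen_of_not_short h₁]
    by_cases h₂ : dist (z₀ a) (z₀ b) ≤ ℓc ∧ min (dist (z₀ a) (z₀ c₀)) (dist (z₀ b) (z₀ c₀)) ≤ RE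
    · rw [relConeLen_of_short h₂]
      nlinarith [h₂.1]
    · rw [relConeLen_of_not_short h₂]

end RelConeLen

/-! ## §2. Host-graded collar; comparison with the record's `relConeBy` -/

/-- ★ (piece) [route statement · this cell; NOT a literature fact] `relConeLenBy RE ℓc βf sf τ₀` — the collar with cone parameters READ OFF THE HOST CHART. -/
def relConeLenBy (RE ℓc : ℝ) (βf sf : (M₀ : ℕ) → (Fin M₀ → E3) → Fin M₀ → ℝ) (τ₀ : ℝ) : PairTab :=
  fun M₀ z₀ c₀ a b => relConeLen RE ℓc (βf M₀ z₀ c₀) (sf M₀ z₀ c₀) τ₀ M₀ z₀ c₀ a b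

section RelConeLenBy

variable {RE ℓc τ₀ : ℝ} {βf sf : (M₀ : ℕ) → (Fin M₀ → E3) → Fin M₀ → ℝ}

/-- [formal bookkeeping; lane docstring, hand-2 g42] -/
theorem relConeLenBy_const (RE ℓc β s τ₀ : ℝ) : relConeLenBy RE ℓc (fun _ _ _ => β) (fun _ _ _ => s) τ₀ = relConeLen RE ℓc β s τ₀ := rfl

/-- At `ℓc = 9/2` the host-graded collar IS `relConeBy`. [formal bookkeeping] -/
theorem relConeLenBy_nine_halves (RE : ℝ) (βf sf : (M₀ : ℕ) → (Fin M₀ → E3) → Fin M₀ → ℝ) (τ₀ : ℝ) :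
    relConeLenBy RE (9 / 2) βf sf τ₀ = relConeBy RE βf sf τ₀ := rfl

/-- ★ `relConeBy ≤ relConeLenBy` host by host (`ℓc ≤ 9/2`, slopes `≥ 0`, cap at `9/2`). [formal bookkeeping] -/
theorem relConeBy_le_relConeLenBy (hℓ : ℓc ≤ 9 / 2) (hs0 : ∀ M₀ z₀ c₀, 0 ≤ sf M₀ z₀ c₀)
    (hcap : ∀ M₀ z₀ c₀, βf M₀ z₀ c₀ + sf M₀ z₀ c₀ * (9 / 2) ≤ 2 * τ₀) :
    PairLE (relConeBy RE βf sf τ₀) (relConeLenBy RE ℓc βf sf τ₀) :=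
  fun M₀ z₀ c₀ a b => relCone_le_relConeLen hℓ (hs0 M₀ z₀ c₀) (hcap M₀ z₀ c₀) M₀ z₀ c₀ a b

/-- ★ The host-graded collar is capped by the scalar site sums (`βf + sf·ℓc ≤ 2τ₀`, `sf ≥ 0` per host). [formal bookkeeping] -/
theorem relConeLenBy_le_pairSum (hs0 : ∀ M₀ z₀ c₀, 0 ≤ sf M₀ z₀ c₀) (hcap : ∀ M₀ z₀ c₀, βf M₀ z₀ c₀ + sf M₀ z₀ c₀ * ℓc ≤ 2 * τ₀) :
    PairLE (relConeLenBy RE ℓc βf sf τ₀) (pairSum (constTol τ₀)) :=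
  fun M₀ z₀ c₀ a b => relConeLen_le_pairSum (hs0 M₀ z₀ c₀) (hcap M₀ z₀ c₀) M₀ z₀ c₀ a b

end RelConeLenBy

/-! ## §3. Generic host-class glue of pair tables -/

/-- (piece) [route statement · this cell; NOT a literature fact] `stepPair 𝓟 B₁ B₂` — the table `B₁` on `𝓟`-hosts, `B₂` off them (a pair table is read AT THE HOST CHART). -/
def stepPair (𝓟 : ChartFam) (B₁ B₂ : PairTab) : PairTab :=
  fun M₀ z₀ c₀ a b => if 𝓟 M₀ z₀ c₀ then B₁ M₀ z₀ c₀ a b else B₂ M₀ z₀ c₀ a b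

section StepPair

variable {𝓘 𝓟 : ChartFam} {B B₁ B₂ : PairTab} {T : SlackTab} {τ : ℝ} {M₀ : ℕ} {z₀ : Fin M₀ → E3} {c₀ : Fin M₀}

/-- [formal bookkeeping; lane docstring, hand-2 g42] -/
theorem stepPair_of_pos (h : 𝓟 M₀ z₀ c₀) (a b : Fin M₀) : stepPair 𝓟 B₁ B₂ M₀ z₀ c₀ a b = B₁ M₀ z₀ c₀ a b := by
  simp [stepPair, h]

/-- [formal bookkeeping; lane docstring, hand-2 g42] -/
theorem stepPair_of_neg (h : ¬𝓟 M₀ z₀ c₀) (a b : Fin M₀) : stepPair 𝓟 B₁ B₂ M₀ z₀ c₀ a b = B₂ M₀ z₀ c₀ a b := by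
  simp [stepPair, h]

/-- The tree's `sectorPair` is the step to the pair-blind site sums. [formal bookkeeping] -/
theorem sectorPair_eq_stepPair (𝓟 : ChartFam) (B : PairTab) (T : SlackTab) : sectorPair 𝓟 B T = stepPair 𝓟 B (pairSum T) := by
  funext M₀ z₀ c₀ a b
  by_cases h : 𝓟 M₀ z₀ c₀
  · rw [sectorPair_of_pos h, stepPair_of_pos h]
  · rw [sectorPair_of_neg h, stepPair_of_neg h]

/-- The record's glued `relConeBy (stepByF …)` is the step of the two `relConeBy` tables; likewise for the collar. [formal bookkeeping] -/
theorem relConeLenBy_stepByF (𝓟 : ChartFam) (RE ℓc τ₀ : ℝ) (f₁ f₂ g₁ g₂ : (M₀ : ℕ) → (Fin M₀ → E3) → Fin M₀ → ℝ) :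
    relConeLenBy RE ℓc (stepByF 𝓟 f₁ f₂) (stepByF 𝓟 g₁ g₂) τ₀ = stepPair 𝓟 (relConeLenBy RE ℓc f₁ g₁ τ₀) (relConeLenBy RE ℓc f₂ g₂ τ₀) := by
  funext M₀ z₀ c₀ a b
  by_cases h : 𝓟 M₀ z₀ c₀
  · rw [stepPair_of_pos h]; simp only [relConeLenBy, stepByF_of_pos h]
  · rw [stepPair_of_neg h]; simp only [relConeLenBy, stepByF_of_neg h]

/-- [formal bookkeeping; lane docstring, hand-2 g42] -/
theorem relConeBy_stepByF (𝓟 : ChartFam) (RE τ₀ : ℝ) (f₁ f₂ g₁ g₂ : (M₀ : ℕ) → (Fin M₀ → E3) → Fin M₀ → ℝ) :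
    relConeBy RE (stepByF 𝓟 f₁ f₂) (stepByF 𝓟 g₁ g₂) τ₀ = stepPair 𝓟 (relConeBy RE f₁ g₁ τ₀) (relConeBy RE f₂ g₂ τ₀) := by
  funext M₀ z₀ c₀ a b
  by_cases h : 𝓟 M₀ z₀ c₀
  · rw [stepPair_of_pos h]; simp only [relConeBy, stepByF_of_pos h]
  · rw [stepPair_of_neg h]; simp only [relConeBy, stepByF_of_neg h]

/-- ★★ GENERIC E-SIDE GLUE: class cells at ANY two tables ⟹ the one cell at the stepped table. [formal bookkeeping] -/
theorem tubeFloorGB_stepPair (h₁ : TubeFloorGB (famAnd 𝓘 𝓟) τ T B₁) (h₂ : TubeFloorGB (famAndNot 𝓘 𝓟) τ T B₂) :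
    TubeFloorGB 𝓘 τ T (stepPair 𝓟 B₁ B₂) := by
  intro M z c M₀ z₀ c₀ e hz hcl hm hch
  by_cases hp : 𝓟 M₀ z₀ c₀
  · exact h₁ M z c M₀ z₀ c₀ e hz hcl hm ((hch.congr_pair fun a b => stepPair_of_pos hp a b).toClass hp)
  · exact h₂ M z c M₀ z₀ c₀ e hz hcl hm ((hch.congr_pair fun a b => stepPair_of_neg hp a b).toOffClass hp)

/-- … and its EXACTNESS: the stepped cell restricts to each class cell. [formal bookkeeping] -/
theorem tubeFloorGB_famAnd_of_stepPair (h : TubeFloorGB 𝓘 τ T (stepPair 𝓟 B₁ B₂)) : TubeFloorGB (famAnd 𝓘 𝓟) τ T B₁ := by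
  intro M z c M₀ z₀ c₀ e hz hcl hm hch
  have hp : 𝓟 M₀ z₀ c₀ := (chartByG_mem hch.chartByG).2
  exact h M z c M₀ z₀ c₀ e hz hcl hm ((hch.mono_family famAnd_le).congr_pair fun a b => (stepPair_of_pos hp a b).symm)

/-- [formal bookkeeping; lane docstring, hand-2 g42] -/
theorem tubeFloorGB_famAndNot_of_stepPair (h : TubeFloorGB 𝓘 τ T (stepPair 𝓟 B₁ B₂)) : TubeFloorGB (famAndNot 𝓘 𝓟) τ T B₂ := by
  intro M z c M₀ z₀ c₀ e hz hcl hm hch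
  have hp : ¬𝓟 M₀ z₀ c₀ := (chartByG_mem hch.chartByG).2
  exact h M z c M₀ z₀ c₀ e hz hcl hm ((hch.mono_family famAndNot_le).congr_pair fun a b => (stepPair_of_neg hp a b).symm)

/-- The stepped table is capped when both pieces are. [formal bookkeeping] -/
theorem stepPair_le (h₁ : PairLE B₁ B) (h₂ : PairLE B₂ B) : PairLE (stepPair 𝓟 B₁ B₂) B := by
  intro M₀ z₀ c₀ a b
  by_cases h : 𝓟 M₀ z₀ c₀
  · rw [stepPair_of_pos h]; exact h₁ M₀ z₀ c₀ a b
  · rw [stepPair_of_neg h]; exact h₂ M₀ z₀ c₀ a b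

end StepPair

/-! ## §4. The collar cells of the door 𝔇′ and the transfer lemmas -/

section Cells

variable {𝓘₀ 𝓘 𝓙 : ChartFam} {ρ ε τ RE ℓc τ₀ : ℝ} {T : SlackTab} {βf sf : (M₀ : ℕ) → (Fin M₀ → E3) → Fin M₀ → ℝ}

/-- (piece) [route statement · this cell; NOT a literature fact] **(E∣·)ᴸ** the collar E-cell of a host class `𝓙` at `(RE, τ₀) = (2, 1/25)`: energy floor on every cluster charted within the COLLARED cone boxes. -/
def TubeFloorGBLenBy (𝓙 : ChartFam) (ℓc : ℝ) (βf sf : (M₀ : ℕ) → (Fin M₀ → E3) → Fin M₀ → ℝ) : Prop :=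
  TubeFloorGB 𝓙 (1 / 25) (constTol (1 / 25)) (relConeLenBy 2 ℓc βf sf (1 / 25))

/-- (piece) [route statement · this cell; NOT a literature fact] **(N∣·)ᴸ** the collar N-cell (pair refinement residual) of a host class at `(ρ, ε)`: the refit's pair displacements obey the cone on SHORT pairs only. -/
def RefineGBLenByAt (𝓘₀ 𝓙 : ChartFam) (ρ ε ℓc : ℝ) (βf sf : (M₀ : ℕ) → (Fin M₀ → E3) → Fin M₀ → ℝ) : Prop :=
  RefineGB 𝓘₀ 𝓙 ρ ε (1 / 8) (1 / 25) (constTol (1 / 25)) (1 / 25) (constTol (1 / 25)) (relConeLenBy 2 ℓc βf sf (1 / 25))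

/-- At `ℓc = 9/2` the collar cells ARE the record cells. [formal bookkeeping] -/
theorem tubeFloorGBLenBy_nine_halves (𝓙 : ChartFam) (βf sf : (M₀ : ℕ) → (Fin M₀ → E3) → Fin M₀ → ℝ) :
    TubeFloorGBLenBy 𝓙 (9 / 2) βf sf ↔ TubeFloorGBRecBy 𝓙 βf sf := Iff.rfl

/-- [formal bookkeeping; lane docstring, hand-2 g42] -/
theorem refineGBLenByAt_nine_halves (𝓘₀ 𝓙 : ChartFam) (ρ ε : ℝ) (βf sf : (M₀ : ℕ) → (Fin M₀ → E3) → Fin M₀ → ℝ) :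
    RefineGBLenByAt 𝓘₀ 𝓙 ρ ε (9 / 2) βf sf ↔ RefineGBRecByAt 𝓘₀ 𝓙 ρ ε βf sf := Iff.rfl

/-- ★ TRANSFER, E-side: the collar E-cell is the STRONGER one — it gives back the record E-cell (`TubeFloorGB` antitone in the table). [formal bookkeeping] -/
theorem tubeFloorGBRecBy_of_lenBy (hℓ : ℓc ≤ 9 / 2) (hs0 : ∀ M₀ z₀ c₀, 0 ≤ sf M₀ z₀ c₀)
    (hcap : ∀ M₀ z₀ c₀, βf M₀ z₀ c₀ + sf M₀ z₀ c₀ * (9 / 2) ≤ 2 * (1 / 25)) (h : TubeFloorGBLenBy 𝓙 ℓc βf sf) : TubeFloorGBRecBy 𝓙 βf sf :=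
  h.anti_pair (relConeBy_le_relConeLenBy hℓ hs0 hcap)

/-- ★ TRANSFER, N-side: the collar N-cell is the WEAKER one — the record N-cell gives it (`RefineGB` monotone in the table). [formal bookkeeping] -/
theorem refineGBLenByAt_of_recByAt (hℓ : ℓc ≤ 9 / 2) (hs0 : ∀ M₀ z₀ c₀, 0 ≤ sf M₀ z₀ c₀)
    (hcap : ∀ M₀ z₀ c₀, βf M₀ z₀ c₀ + sf M₀ z₀ c₀ * (9 / 2) ≤ 2 * (1 / 25)) (h : RefineGBRecByAt 𝓘₀ 𝓙 ρ ε βf sf) :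
    RefineGBLenByAt 𝓘₀ 𝓙 ρ ε ℓc βf sf :=
  h.mono (familyLE_refl _) (TolLE.refl _) (relConeBy_le_relConeLenBy hℓ hs0 hcap) le_rfl

/-- The cells of record: the LENGTH collar `ℓ_c = 29/10` (row 1617 (2)); `(βf, sf)` the door's host-graded record cone. -/
theorem tubeFloorGBLenBy_record_def (𝓙 : ChartFam) (βf sf : (M₀ : ℕ) → (Fin M₀ → E3) → Fin M₀ → ℝ) :
    TubeFloorGBLenBy 𝓙 (29 / 10) βf sf = TubeFloorGB 𝓙 (1 / 25) (constTol (1 / 25)) (relConeLenBy 2 (29 / 10) βf sf (1 / 25)) := rfl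

/-- [formal bookkeeping; lane docstring, hand-2 g42] -/
theorem collar_record_le_nine_halves : (29 : ℝ) / 10 ≤ 9 / 2 := by norm_num

end Cells

/-! ## §5. Junctions: the collar pair on a family; the three- and four-sector cuts with the collar on 𝔇′ only -/

section Junction

variable {𝓘₀ 𝓗 𝓘 𝓡 : ChartFam} {dA dB ℓc : ℝ} {βf βf₁ βf₂ βf₃ sf sf₁ sf₂ sf₃ : (M₀ : ℕ) → (Fin M₀ → E3) → Fin M₀ → ℝ}

/-- ★★ [CORE-FAR] OF RECORD from the collar pair on ONE family (B-generic root `coreOff_of_tubeFloorGB_of_coarse_of_refineGB` at the `26/5` core). -/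
theorem coreOff_record_of_collarPair_at_26_5 (hT : TubeFloorGBLenBy 𝓘 ℓc βf sf) (hK : FamilyCoverGRecAt 𝓘₀ (26 / 5) (1 / 100))
    (hD : RefineGBLenByAt 𝓘₀ 𝓘 (26 / 5) (1 / 100) ℓc βf sf) : CoreOffTubeFloor (63 / 10) (63 / 10) (24 / 5) (1 / 100) 0 :=
  (coreOff_of_tubeFloorGB_of_coarse_of_refineGB hT hK hD).of_le_core (by norm_num)

/-- The dilated sector's pair-blind scalar floor as a GB-cell at the site sums. [formal bookkeeping] -/
theorem tubeFloorGB_pairSum_of_tubeFloor {𝓙 : ChartFam} (h : TubeFloor 𝓙 (1 / 25)) :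
    TubeFloorGB 𝓙 (1 / 25) (constTol (1 / 25)) (pairSum (constTol (1 / 25))) :=
  tubeFloorGB_pairSum_iff.2 (tubeFloorG_constTol_iff.2 h)

/-- ★★★ **THREE-SECTOR CUT WITH THE COLLAR ON 𝔇′** (𝔇′ = dense ∧ `𝓡`, 𝔅 = dense ∧ `¬𝓡`, 𝔄 = dilated): (E∣𝔇′)ᴸ ∧ (E∣𝔅) ∧ (E∣𝔄) ∧ cover ∧ (N∣𝔇′) ∧ (N∣𝔅) at
the ONE dense-side table `stepPair 𝓡 (collar) (band cone)` ∧ hull sandwich ∧ cap ⟹ [CORE-FAR] of record. [folklore: the record junction with §3's glue] -/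
theorem coreOff_record_of_threeSector_collar_at_26_5
    (hED : TubeFloorGBLenBy (famAnd (famAnd 𝓘 (Dense dA)) 𝓡) ℓc βf₁ sf₁)
    (hEB : TubeFloorGB (famAndNot (famAnd 𝓘 (Dense dA)) 𝓡) (1 / 25) (constTol (1 / 25)) (relConeBy 2 βf₂ sf₂ (1 / 25)))
    (hEA : TubeFloor (famAndNot 𝓘 (Dense dA)) (1 / 25))
    (hK : FamilyCoverGRecAt 𝓘₀ (26 / 5) (1 / 100))
    (hND : RefineGB (famAnd (famAnd 𝓘₀ (Dense dA)) 𝓡) 𝓗 (26 / 5) (1 / 100) (1 / 8) (1 / 25) (constTol (1 / 25)) (1 / 25) (constTol (1 / 25))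
      (stepPair 𝓡 (relConeLenBy 2 ℓc βf₁ sf₁ (1 / 25)) (relConeBy 2 βf₂ sf₂ (1 / 25))))
    (hNB : RefineGB (famAndNot (famAnd 𝓘₀ (Dense dA)) 𝓡) 𝓗 (26 / 5) (1 / 100) (1 / 8) (1 / 25) (constTol (1 / 25)) (1 / 25) (constTol (1 / 25))
      (stepPair 𝓡 (relConeLenBy 2 ℓc βf₁ sf₁ (1 / 25)) (relConeBy 2 βf₂ sf₂ (1 / 25))))
    (h𝓗 : FamilyLE (famAndNot 𝓘₀ (Dense dA)) 𝓗)
    (hcap : PairLE (stepPair 𝓡 (relConeLenBy 2 ℓc βf₁ sf₁ (1 / 25)) (relConeBy 2 βf₂ sf₂ (1 / 25))) (pairSum (constTol (1 / 25))))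
    (h𝓘 : FamilyLE 𝓗 𝓘) : CoreOffTubeFloor (63 / 10) (63 / 10) (24 / 5) (1 / 100) 0 := by
  have hE : TubeFloorGB 𝓘 (1 / 25) (constTol (1 / 25))
      (sectorPair (Dense dA) (stepPair 𝓡 (relConeLenBy 2 ℓc βf₁ sf₁ (1 / 25)) (relConeBy 2 βf₂ sf₂ (1 / 25))) (constTol (1 / 25))) := by
    rw [sectorPair_eq_stepPair]
    exact tubeFloorGB_stepPair (tubeFloorGB_stepPair hED hEB) (tubeFloorGB_pairSum_of_tubeFloor hEA)
  have hN := (refineGB_threeSector hND hNB h𝓗 le_rfl (TolLE.refl _) hcap).mono h𝓘 (TolLE.refl _) (PairLE.refl _) le_rfl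
  exact (coreOff_of_tubeFloorGB_of_coarse_of_refineGB hE hK hN).of_le_core (by norm_num)

/-- ★★★ **FOUR-SECTOR CUT WITH THE COLLAR ON 𝔇′** (edition 2: the band re-dialled at `dB` into 𝔅lo/𝔅hi at their own `relConeBy` cones). [folklore] -/
theorem coreOff_record_of_fourSector_collar_at_26_5
    (hED : TubeFloorGBLenBy (famAnd (famAnd 𝓘 (Dense dA)) 𝓡) ℓc βf₁ sf₁)
    (hEBlo : TubeFloorGB (famAnd (famAndNot (famAnd 𝓘 (Dense dA)) 𝓡) (Dense dB)) (1 / 25) (constTol (1 / 25)) (relConeBy 2 βf₂ sf₂ (1 / 25)))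
    (hEBhi : TubeFloorGB (famAndNot (famAndNot (famAnd 𝓘 (Dense dA)) 𝓡) (Dense dB)) (1 / 25) (constTol (1 / 25)) (relConeBy 2 βf₃ sf₃ (1 / 25)))
    (hEA : TubeFloor (famAndNot 𝓘 (Dense dA)) (1 / 25))
    (hK : FamilyCoverGRecAt 𝓘₀ (26 / 5) (1 / 100))
    (hND : RefineGB (famAnd (famAnd 𝓘₀ (Dense dA)) 𝓡) 𝓗 (26 / 5) (1 / 100) (1 / 8) (1 / 25) (constTol (1 / 25)) (1 / 25) (constTol (1 / 25))
      (stepPair 𝓡 (relConeLenBy 2 ℓc βf₁ sf₁ (1 / 25)) (relConeBy 2 (stepByF (Dense dB) βf₂ βf₃) (stepByF (Dense dB) sf₂ sf₃) (1 / 25))))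
    (hNBlo : RefineGB (famAnd (famAndNot (famAnd 𝓘₀ (Dense dA)) 𝓡) (Dense dB)) 𝓗 (26 / 5) (1 / 100) (1 / 8) (1 / 25) (constTol (1 / 25)) (1 / 25)
      (constTol (1 / 25)) (stepPair 𝓡 (relConeLenBy 2 ℓc βf₁ sf₁ (1 / 25)) (relConeBy 2 (stepByF (Dense dB) βf₂ βf₃) (stepByF (Dense dB) sf₂ sf₃) (1 / 25))))
    (hNBhi : RefineGB (famAndNot (famAndNot (famAnd 𝓘₀ (Dense dA)) 𝓡) (Dense dB)) 𝓗 (26 / 5) (1 / 100) (1 / 8) (1 / 25) (constTol (1 / 25)) (1 / 25)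
      (constTol (1 / 25)) (stepPair 𝓡 (relConeLenBy 2 ℓc βf₁ sf₁ (1 / 25)) (relConeBy 2 (stepByF (Dense dB) βf₂ βf₃) (stepByF (Dense dB) sf₂ sf₃) (1 / 25))))
    (h𝓗 : FamilyLE (famAndNot 𝓘₀ (Dense dA)) 𝓗)
    (hcap : PairLE (stepPair 𝓡 (relConeLenBy 2 ℓc βf₁ sf₁ (1 / 25)) (relConeBy 2 (stepByF (Dense dB) βf₂ βf₃) (stepByF (Dense dB) sf₂ sf₃) (1 / 25)))
      (pairSum (constTol (1 / 25))))
    (h𝓘 : FamilyLE 𝓗 𝓘) : CoreOffTubeFloor (63 / 10) (63 / 10) (24 / 5) (1 / 100) 0 :=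
  coreOff_record_of_threeSector_collar_at_26_5 hED (tubeFloorGB_band_of_two hEBlo hEBhi) hEA hK hND (refineGB_band_of_two hNBlo hNBhi) h𝓗 hcap h𝓘

/-- ★ The junctions' cap from per-host caps: collar on `𝓡`-hosts (`βf₁ + sf₁·ℓc ≤ 2/25`), record cone off them (`βf₂ + sf₂·(9/2) ≤ 2/25`), slopes `≥ 0`. -/
theorem stepPair_collar_le_pairSum (hs1 : ∀ M₀ z₀ c₀, 0 ≤ sf₁ M₀ z₀ c₀) (hc1 : ∀ M₀ z₀ c₀, βf₁ M₀ z₀ c₀ + sf₁ M₀ z₀ c₀ * ℓc ≤ 2 * (1 / 25))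
    (hs2 : ∀ M₀ z₀ c₀, 0 ≤ sf₂ M₀ z₀ c₀) (hc2 : ∀ M₀ z₀ c₀, βf₂ M₀ z₀ c₀ + sf₂ M₀ z₀ c₀ * (9 / 2) ≤ 2 * (1 / 25)) :
    PairLE (stepPair 𝓡 (relConeLenBy 2 ℓc βf₁ sf₁ (1 / 25)) (relConeBy 2 βf₂ sf₂ (1 / 25))) (pairSum (constTol (1 / 25))) :=
  stepPair_le (relConeLenBy_le_pairSum hs1 hc1)
    (fun M₀ z₀ c₀ a b => relConeLen_le_pairSum (ℓc := 9 / 2) (hs2 M₀ z₀ c₀) (hc2 M₀ z₀ c₀) M₀ z₀ c₀ a b)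

/-- ★ CONSISTENCY: at `ℓc = 9/2` the collared three-sector junction is the record one's hypotheses verbatim (the stepped table is `relConeBy (stepByF …)`). -/
theorem stepPair_nine_halves_eq_record (𝓡 : ChartFam) (βf₁ βf₂ sf₁ sf₂ : (M₀ : ℕ) → (Fin M₀ → E3) → Fin M₀ → ℝ) :
    stepPair 𝓡 (relConeLenBy 2 (9 / 2) βf₁ sf₁ (1 / 25)) (relConeBy 2 βf₂ sf₂ (1 / 25)) = relConeBy 2 (stepByF 𝓡 βf₁ βf₂) (stepByF 𝓡 sf₁ sf₂) (1 / 25) := by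
  rw [relConeLenBy_nine_halves, relConeBy_stepByF]

end Junction

end Summit.AtomisticToContinuum.Crystallization.Theorems.FrustratedLawDichotomyStrainedPatchPairTubeCollar

end
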